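import Literature.Geometry.Riemannian.MetricFlowSliceUnion
import Literature.Geometry.Riemannian.GromovW1Distance
import HarnessLib

/-!
# The coupling `q = ∫ (ν_{y;s} ⊗ δ_y) dμ_t(y)` and the `GW₁`-bound between nearby slices (Bamler
# 2023, §4.2, Proposition, (d), (e))

R. Bamler, *Compactness theory of the space of super Ricci flows*, Invent. Math. 233 (2023), §4.2,
Proposition (closeness of nearby time-slices), assertions (d) and (e): *"The probability measure
`q := ∫_{𝒳_t} (ν_{y;s} ⊗ δ_y) dμ_t(y)` is a coupling between `μ_s, μ_t` and
`∫_{𝒳_s × 𝒳_t} d_Z(φ_s(x), φ_t(y)) dq(x, y) = ∫_{𝒳_t}∫_{𝒳_s} d_Z(φ_s(x), φ_t(y)) dν_{y;s}(x) dμ_t(y)`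
… (e) `d_{GW₁}((𝒳_s, d_s, μ_s), (𝒳_t, d_t, μ_t)) ≤ d^Z_{W₁}((φ_s)_* μ_s, (φ_t)_* μ_t)`"*, which
is then `≤ ∫ d_Z(φ_s(x), φ_t(y)) dq` — *"The fact that `q` … is a coupling between `μ_s, μ_t` and
the equality in (4.8) are clear … Assertion (e) is a direct consequence of Assertion (d)"*. Here
`Z = 𝒳_s ⊔ 𝒳_t` is the space of the Lemma (construction of `Z`) (`MetricFlowSliceUnion.lean`),
but (d), (e) hold for any metric space `Z` with isometric embeddings of the two slices:

* `MetricFlow.IsConjugateHeatFlow.sliceCoupling`, `….isCoupling_sliceCoupling` — `q` and (d);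
* `MetricFlow.IsConjugateHeatFlow.lintegral_sliceCoupling` — the equality in (4.8);
* `MetricFlow.IsConjugateHeatFlow.gromovW1_le_lintegral_lintegral` — **(e)**:
  `d_{GW₁}((𝒳_s, μ_s), (𝒳_t, μ_t)) ≤ ∫_{𝒳_t}∫_{𝒳_s} d_Z(φ_s(x), φ_t(y)) dν_{y;s}(x) dμ_t(y)`.

Everything is proved; the only definition is `q`; no named facts.

## References

* R. H. Bamler, *Compactness theory of the space of super Ricci flows*, Invent. Math. 233 (2023),
  §4.2, Proposition (closeness of nearby time-slices), (d), (e), (4.8). [Bamler2023]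
-/

noncomputable section

open Set MeasureTheory ProbabilityTheory Filter Topology
open scoped ENNReal NNReal

namespace Literature.Geometry.Riemannian

universe u

namespace MetricFlow

variable {I : Set ℝ} {𝒳 : MetricFlow.{u} I}

/-- **The coupling `q := ∫_{𝒳_t} (ν_{y;s} ⊗ δ_y) dμ_t(y)`** between `μ_s` and `μ_t` (Bamler 2023,
§4.2, Proposition (d)): the composition-product `μ_t ⊗ ν_{·;s}` with its factors swapped.
[cite: Bamler2023, §4.2, Proposition (closeness of nearby time-slices), (d)] -/
def IsConjugateHeatFlow.sliceCoupling {I' : Set ℝ} {μ : ∀ t : I, Measure (𝒳.Slice t)}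
    (_hμ : 𝒳.IsConjugateHeatFlow I' μ) {s t : I} (hst : (s : ℝ) ≤ t) :
    Measure (𝒳.Slice s × 𝒳.Slice t) :=
  ((μ t) ⊗ₘ (𝒳.kernel hst)).map Prod.swap

/-- **`q` is a coupling between `μ_s` and `μ_t`** (Bamler 2023, §4.2, Proposition (d): *"clear"* —
the second marginal of `μ_t ⊗ ν_{·;s}` is `∫ ν_{y;s} dμ_t(y) = μ_s` by the conjugate heat flow
property, the first is `μ_t`). [cite: Bamler2023, §4.2, Proposition (closeness of nearby time-slices), (d)] -/
theorem IsConjugateHeatFlow.isCoupling_sliceCoupling {I' : Set ℝ} {μ : ∀ t : I, Measure (𝒳.Slice t)}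
    (hμ : 𝒳.IsConjugateHeatFlow I' μ) {s t : I} (hs : (s : ℝ) ∈ I') (ht : (t : ℝ) ∈ I')
    (hst : (s : ℝ) ≤ t) : IsCoupling (μ s) (μ t) (hμ.sliceCoupling hst) := by
  haveI := hμ.1 t ht
  refine ⟨Measure.isProbabilityMeasure_map measurable_swap.aemeasurable, ?_, ?_⟩
  · rw [IsConjugateHeatFlow.sliceCoupling, Measure.fst_map_swap, Measure.snd_compProd,
      ← hμ.eq_bind hs ht hst]
  · rw [IsConjugateHeatFlow.sliceCoupling, Measure.snd_map_swap, Measure.fst_compProd]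

/-- **The equality in (4.8)**: `∫_{𝒳_s × 𝒳_t} F dq = ∫_{𝒳_t}∫_{𝒳_s} F(x, y) dν_{y;s}(x) dμ_t(y)`
for measurable `F ≥ 0`. [cite: Bamler2023, §4.2, Proposition (closeness of nearby time-slices), (4.8)] -/
theorem IsConjugateHeatFlow.lintegral_sliceCoupling {I' : Set ℝ} {μ : ∀ t : I, Measure (𝒳.Slice t)}
    (hμ : 𝒳.IsConjugateHeatFlow I' μ) {s t : I} (ht : (t : ℝ) ∈ I') (hst : (s : ℝ) ≤ t)
    {F : 𝒳.Slice s × 𝒳.Slice t → ℝ≥0∞} (hF : Measurable F) :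
    ∫⁻ p, F p ∂(hμ.sliceCoupling hst) = ∫⁻ y, ∫⁻ x, F (x, y) ∂(𝒳.condKernel y s) ∂(μ t) := by
  haveI := hμ.1 t ht
  rw [IsConjugateHeatFlow.sliceCoupling, lintegral_map hF measurable_swap,
    Measure.lintegral_compProd
      (show Measurable (fun a : 𝒳.Slice t × 𝒳.Slice s ↦ F a.swap) from hF.comp measurable_swap)]
  rfl

/-- **`d_{GW₁}((𝒳_s, d_s, μ_s), (𝒳_t, d_t, μ_t)) ≤ ∫_{𝒳_t}∫_{𝒳_s} d_Z(φ_s(x), φ_t(y)) dν_{y;s}(x) dμ_t(y)`**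
(Bamler 2023, §4.2, Proposition (e) with (d): *"a direct consequence of Assertion (d)"*), for
any metric space `Z` (in the universe of the slices) with its Borel σ-algebra and isometric
embeddings `φ_s : 𝒳_s → Z`, `φ_t : 𝒳_t → Z`: `d_{GW₁} ≤ d^Z_{W₁}((φ_s)_* μ_s, (φ_t)_* μ_t) ≤
∫ d_Z d((φ_s × φ_t)_* q) = ∫_{𝒳_t}∫_{𝒳_s} d_Z(φ_s(x), φ_t(y)) dν_{y;s}(x) dμ_t(y)`.
[cite: Bamler2023, §4.2, Proposition (closeness of nearby time-slices), (e)] -/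
theorem IsConjugateHeatFlow.gromovW1_le_lintegral_lintegral {I' : Set ℝ}
    {μ : ∀ t : I, Measure (𝒳.Slice t)} (hμ : 𝒳.IsConjugateHeatFlow I' μ) {s t : I}
    (hs : (s : ℝ) ∈ I') (ht : (t : ℝ) ∈ I') (hst : (s : ℝ) ≤ t) {Z : Type u} [MetricSpace Z]
    [MeasurableSpace Z] [BorelSpace Z] {φs : 𝒳.Slice s → Z} {φt : 𝒳.Slice t → Z}
    (hφs : Isometry φs) (hφt : Isometry φt) :
    gromovW1 (μ s) (μ t) ≤ ∫⁻ y, ∫⁻ x, edist (φs x) (φt y) ∂(𝒳.condKernel y s) ∂(μ t) := by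
  haveI := hμ.1 t ht
  haveI : SecondCountableTopology (𝒳.Slice s) := UniformSpace.secondCountable_of_separable _
  haveI : SecondCountableTopology (𝒳.Slice t) := UniformSpace.secondCountable_of_separable _
  obtain ⟨hqP, hq1, hq2⟩ := hμ.isCoupling_sliceCoupling hs ht hst
  haveI := hqP
  have hΦ : Measurable (Prod.map φs φt) :=
    (hφs.continuous.measurable.comp measurable_fst).prodMk
      (hφt.continuous.measurable.comp measurable_snd)
  -- the pushed-forward coupling
  have hc : IsCoupling ((μ s).map φs) ((μ t).map φt) ((hμ.sliceCoupling hst).map (Prod.map φs φt)) := by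
    refine ⟨Measure.isProbabilityMeasure_map hΦ.aemeasurable, ?_, ?_⟩
    · rw [Measure.fst, Measure.map_map measurable_fst hΦ, ← hq1, Measure.fst,
        Measure.map_map hφs.continuous.measurable measurable_fst]
      rfl
    · rw [Measure.snd, Measure.map_map measurable_snd hΦ, ← hq2, Measure.snd,
        Measure.map_map hφt.continuous.measurable measurable_snd]
      rfl
  have hF : Measurable fun p : 𝒳.Slice s × 𝒳.Slice t ↦ edist (φs p.1) (φt p.2) :=
    ((hφs.continuous.comp continuous_fst).edist (hφt.continuous.comp continuous_snd)).measurable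
  calc gromovW1 (μ s) (μ t) ≤ wassersteinW1 ((μ s).map φs) ((μ t).map φt) :=
        gromovW1_le_wassersteinW1_map _ _ hφs hφt
    _ ≤ ∫⁻ z, edist z.1 z.2 ∂((hμ.sliceCoupling hst).map (Prod.map φs φt)) :=
        wassersteinW1_le_lintegral hc
    _ ≤ ∫⁻ p, edist (φs p.1) (φt p.2) ∂(hμ.sliceCoupling hst) := lintegral_map_le _ _
    _ = ∫⁻ y, ∫⁻ x, edist (φs x) (φt y) ∂(𝒳.condKernel y s) ∂(μ t) :=
        hμ.lintegral_sliceCoupling ht hst hF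

/-- **(e) in the space `Z = 𝒳_s ⊔ 𝒳_t` of the Lemma (construction of `Z`)**: with
`W ⊆ 𝒳_t` nonempty satisfying (4.9) and `δ > 0`,
`d_{GW₁}((𝒳_s, μ_s), (𝒳_t, μ_t)) ≤ ∫_{𝒳_t}∫_{𝒳_s} d_Z(φ_s(x), φ_t(y)) dν_{y;s}(x) dμ_t(y)`, where
on `W` the integrand is `≤ d_{W₁}(δ_x, ν_{y;s}) + δ` ((4.7),
`MetricFlow.edist_inl_inr_le_wassersteinW1_dirac_add`).
[cite: Bamler2023, §4.2, Proposition (closeness of nearby time-slices), (e)] -/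
theorem IsConjugateHeatFlow.gromovW1_le_lintegral_lintegral_sliceUnion {I' : Set ℝ}
    {μ : ∀ t : I, Measure (𝒳.Slice t)} (hμ : 𝒳.IsConjugateHeatFlow I' μ) {s t : I}
    [CompactSpace (𝒳.Slice s)] (hs : (s : ℝ) ∈ I') (ht : (t : ℝ) ∈ I') (hst : (s : ℝ) ≤ t)
    {W : Set (𝒳.Slice t)} (hW : W.Nonempty) {δ : ℝ} (hδ : 0 < δ)
    (h49 : ∀ w₁ ∈ W, ∀ w₂ ∈ W, edist w₁ w₂ ≤
      wassersteinW1 (𝒳.condKernel w₁ s) (𝒳.condKernel w₂ s) + ENNReal.ofReal δ) :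
    gromovW1 (μ s) (μ t) ≤
      ∫⁻ y, ∫⁻ x, edist (CrossMetricSum.inl (𝒳.sliceCost_hyp hst hW hδ h49) x)
        (CrossMetricSum.inr (𝒳.sliceCost_hyp hst hW hδ h49) y) ∂(𝒳.condKernel y s) ∂(μ t) := by
  letI : MeasurableSpace (CrossMetricSum (𝒳.sliceCost_hyp hst hW hδ h49)) := borel _
  haveI : BorelSpace (CrossMetricSum (𝒳.sliceCost_hyp hst hW hδ h49)) := ⟨rfl⟩
  exact hμ.gromovW1_le_lintegral_lintegral hs ht hst (CrossMetricSum.isometry_inl _)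
    (CrossMetricSum.isometry_inr _)

end MetricFlow

end Literature.Geometry.Riemannian

end
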